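import Mathlib.Analysis.Calculus.InverseFunctionTheorem.ContDiff
import Mathlib.Geometry.Manifold.PartitionOfUnity
import Literature.Analysis.Calculus.SeeleyExtension
import Literature.Topology.FourManifolds.BallGluingCharts
import Literature.Topology.FourManifolds.CorkDecompositionSplittingProof
import Literature.Topology.FourManifolds.StraightLineIsotopyExtension
import HarnessLib

/-!
# Bicollaring the seam of a gluing along a half-disc

Let `jA : A ↪ X` be a smooth embedding of a compact smooth manifold with boundary into a
boundaryless smooth manifold of the same dimension `k + 1`, and let `kA : ℝᵏ⁺¹₊ ↪ A` be a
half-disc (a smooth embedding of the closed half space with open range). The composite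
`G = jA ∘ kA : ℝᵏ⁺¹₊ → X` is a smooth injective immersion of the closed half space. The main result
of this file, `Literature.Topology.FourManifolds.exists_seamBicollar`, extends `G` across the boundary hyperplane: for every
`r ≥ 0` there is a diffeomorphism `K` of an open subset of `ℝᵏ⁺¹` containing the closed upper
half ball of radius `r` onto an open subset of `X`, `C^∞` with `C^∞` inverse, with `K = G` on the
half space and such that `K z ∈ jA(A)` forces `z 0 ≥ 0` (the lower open half space is carried into
the complement of `jA(A)`). This is the bicollaring of the seam `jA(∂A)` of a gluing
`X = A ∪_∂ B` along the face of a half-disc, the analytic core of the proof that gluing witnesses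
may be chosen adapted to a pair of half-discs (`Literature.Topology.FourManifolds.exists_seamAdaptedWitnesses`,
`CorkDecompositionSplittingProof.lean`), i.e. of the uniqueness of the smooth structure on a
gluing (Hirsch, *Differential Topology*, Ch. 8, Thm. 1.9 with Thm. 1.8; Munkres, *Elementary
Differential Topology*, §6).

## Strategy

* §1 Seeley's extension theorem in the coordinates of the model half space
  (`exists_contDiffOn_extension_halfSpace`, from `Literature.Analysis.Calculus.Seeley.exists_contDiffOn_extension`), the
  derivative of a one-sided inverse (`comp_fderiv_eq_id_of_leftInvOn`), a local inverse function
  theorem in chart form (`exists_openPartialHomeomorph_of_hasFDerivAt`); injectivity near a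
  compact set is the tree's `Literature.Topology.FourManifolds.exists_isOpen_injOn_of_isCompact`
  (`StraightLineIsotopyExtension.lean`).
* §2 Two-sided charts: a compatible chart `ψ` of the half space near a boundary point extends to a
  partial diffeomorphism of `ℝᵏ⁺¹` (`exists_twoSided_chart`: Seeley-extend `ψ` and `ψ⁻¹`, the
  one-sided relation `ψ⁻¹ ∘ ψ = id` gives an invertible derivative, then the inverse function
  theorem); consequently an injective immersion of the half space into a boundaryless manifold
  of the same dimension is, near every point, the restriction of a partial diffeomorphism
  (`exists_bicollarChart`).
* §3 Seam charts (`exists_seamChart`: bicollar charts shrunk so as to see `jA(A)` only from above),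
  their patching by a partition of unity on `X` through the *inverses* (`exists_seamCollapse`:
  the average `c = ∑ ρ_x K_x⁻¹` inverts `G` and is a local diffeomorphism along the seam, since
  all `K_x⁻¹` have the same one-sided — hence two-sided — derivative there), and the global
  bicollar (`exists_seamBicollar`: invert `c` on a neighbourhood of the compact piece
  `G {‖y‖ ≤ r}` on which it is injective).

## References

* M. W. Hirsch, *Differential Topology*, GTM 33, Springer (1976), Ch. 8, §1 (Thm. 1.8, 1.9), §2.
* J. R. Munkres, *Elementary Differential Topology*, Princeton (1966), §6.
* R. T. Seeley, *Extension of `C^∞` functions defined in a half space*, Proc. AMS 15 (1964)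
  625–626.
-/

noncomputable section

open Set Function Filter Topology Metric
open scoped Manifold ContDiff

namespace Literature.Topology.FourManifolds

/-! ### §1 Analytic preliminaries -/

/-- Local notation: `𝔼 n` is the model Euclidean space. -/
local notation "𝔼 " n:arg => EuclideanSpace ℝ (Fin n)
/-- Local notation: `ℍ n` is the closed half space. -/
local notation "ℍ " n:arg => EuclideanHalfSpace n

section Coordinates

variable {k : ℕ}

/-- The splitting `ℝᵏ⁺¹ ≅ ℝ × ℝᵏ`, height first: `z ↦ (z 0, tail z)`. [folklore] -/
def heightSplit (k : ℕ) : 𝔼 (k + 1) ≃L[ℝ] ℝ × 𝔼 k :=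
  (BoundaryManifold.consCLE k).symm.trans (ContinuousLinearEquiv.prodComm ℝ (𝔼 k) ℝ)

/-- The first component of the splitting is the height. [folklore] -/
@[simp] theorem heightSplit_apply_fst (z : 𝔼 (k + 1)) : (heightSplit k z).1 = z 0 := rfl

/-- The height of the inverse splitting. [folklore] -/
@[simp] theorem heightSplit_symm_apply_zero (p : ℝ × 𝔼 k) : (heightSplit k).symm p 0 = p.1 := by
  obtain ⟨t, x⟩ := p
  change BoundaryManifold.consCLE k ((ContinuousLinearEquiv.prodComm ℝ (𝔼 k) ℝ).symm (t, x)) 0 = t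
  simp [BoundaryManifold.consCLE_apply_zero]

end Coordinates

section HalfSpaceSeeley

variable {k : ℕ} {F : Type*} [NormedAddCommGroup F] [NormedSpace ℝ F] [CompleteSpace F]

/-- **Seeley's theorem in the coordinates of the model half space**: a map `C^∞` on
`U ∩ {z | 0 ≤ z 0}` (`U ⊆ ℝᵏ⁺¹` open) agrees, near any point `z₀ ∈ U`, on the closed half space
with a map `C^∞` on a full neighbourhood of `z₀` (the content is at points of the boundary
hyperplane `{z 0 = 0}`; elsewhere it is trivial).
[cite: Seeley1964, Theorem] -/
theorem exists_contDiffOn_extension_halfSpace {f : 𝔼 (k + 1) → F} {U : Set (𝔼 (k + 1))}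
    (hU : IsOpen U) {z₀ : 𝔼 (k + 1)} (hz₀ : z₀ ∈ U)
    (hf : ContDiffOn ℝ ∞ f (U ∩ {z | 0 ≤ z 0})) :
    ∃ V : Set (𝔼 (k + 1)), IsOpen V ∧ z₀ ∈ V ∧ V ⊆ U ∧
      ∃ g : 𝔼 (k + 1) → F, ContDiffOn ℝ ∞ g V ∧ EqOn g f (V ∩ {z | 0 ≤ z 0}) := by
  have hco : Continuous fun z : 𝔼 (k + 1) => z 0 := (EuclideanSpace.proj (0 : Fin (k + 1))).continuous
  rcases lt_trichotomy (z₀ 0) 0 with hneg | h0 | hpos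
  · -- below the hyperplane there is nothing to extend
    refine ⟨U ∩ {z | z 0 < 0}, hU.inter (isOpen_lt hco continuous_const), ⟨hz₀, hneg⟩,
      inter_subset_left, fun _ => 0, contDiff_const.contDiffOn, fun z hz => ?_⟩
    exact absurd (show 0 ≤ z 0 from hz.2) (not_le.2 hz.1.2)
  swap
  · -- above the hyperplane `f` itself will do
    refine ⟨U ∩ {z | 0 < z 0}, hU.inter (isOpen_lt continuous_const hco), ⟨hz₀, hpos⟩,
      inter_subset_left, f, hf.mono fun z hz => ⟨hz.1, show 0 ≤ z 0 from le_of_lt hz.2⟩,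
      fun z _ => rfl⟩
  set T := heightSplit k with hT
  have hU' : IsOpen (T.symm ⁻¹' U) := hU.preimage T.symm.continuous
  have hTz₀ : T z₀ = ((0 : ℝ), (T z₀).2) := Prod.ext (by simp [hT, h0]) rfl
  have h0' : ((0 : ℝ), (T z₀).2) ∈ T.symm ⁻¹' U := by
    rw [Set.mem_preimage, ← hTz₀, T.symm_apply_apply]; exact hz₀
  have hf' : ContDiffOn ℝ ∞ (f ∘ T.symm) (T.symm ⁻¹' U ∩ {p | 0 ≤ p.1}) := by
    refine hf.comp T.symm.contDiff.contDiffOn fun p hp => ⟨hp.1, ?_⟩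
    show 0 ≤ T.symm p 0
    rw [hT, heightSplit_symm_apply_zero]; exact hp.2
  obtain ⟨V, hVo, hV0, hVU, g, hg, hgf⟩ := Literature.Analysis.Calculus.Seeley.exists_contDiffOn_extension hU' h0' hf'
  refine ⟨T ⁻¹' V, hVo.preimage T.continuous, ?_, fun z hz => ?_, g ∘ T,
    hg.comp T.contDiff.contDiffOn fun z hz => hz, fun z hz => ?_⟩
  · rw [Set.mem_preimage, hTz₀]; exact hV0
  · have := hVU hz; rwa [Set.mem_preimage, T.symm_apply_apply] at this
  · have h1 := hgf ⟨hz.1, (show 0 ≤ (T z).1 by rw [hT, heightSplit_apply_fst]; exact hz.2)⟩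
    simpa [Function.comp] using h1

end HalfSpaceSeeley

section DerivUnique

variable {E : Type*} [NormedAddCommGroup E] [NormedSpace ℝ E]

/-- **A one-sided left inverse forces an invertible derivative.** If `g` has derivative `G` at
`z₀`, `h` has derivative `H'` at `g z₀`, and `h ∘ g = id` on a set `s` of unique
differentiability at `z₀ ∈ s` (e.g. a closed half space) near `z₀`, then `H' ∘ G = id`. [folklore] -/
theorem comp_fderiv_eq_id_of_leftInvOn {g h : E → E} {G H' : E →L[ℝ] E} {z₀ : E} {s : Set E}
    (hg : HasFDerivAt g G z₀) (hh : HasFDerivAt h H' (g z₀)) (hs : UniqueDiffWithinAt ℝ s z₀)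
    (hz₀ : z₀ ∈ s) (heq : ∀ᶠ z in 𝓝[s] z₀, h (g z) = z) : H'.comp G = ContinuousLinearMap.id ℝ E := by
  have h1 : HasFDerivWithinAt (h ∘ g) (H'.comp G) s z₀ :=
    (hh.comp_hasFDerivWithinAt z₀ hg.hasFDerivWithinAt)
  have h2 : HasFDerivWithinAt (h ∘ g) (ContinuousLinearMap.id ℝ E) s z₀ := by
    refine (hasFDerivWithinAt_id z₀ s).congr_of_eventuallyEq ?_ ?_
    · filter_upwards [heq] with z hz; exact hz
    · have := heq.self_of_nhdsWithin hz₀; exact this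
  exact hs.eq h1 h2

/-- **A map that is the identity on one side has derivative the identity.** If `φ` has
derivative `D` at `z₀ ∈ s`, `s` has the unique differentiability property at `z₀` (e.g. a closed
half space) and `φ = id` on `s` near `z₀`, then `D = id`. [folklore] -/
theorem fderiv_eq_id_of_eventuallyEq {φ : E → E} {D : E →L[ℝ] E} {z₀ : E} {s : Set E}
    (hφ : HasFDerivAt φ D z₀) (hs : UniqueDiffWithinAt ℝ s z₀) (hz₀ : z₀ ∈ s)
    (heq : ∀ᶠ z in 𝓝[s] z₀, φ z = z) : D = ContinuousLinearMap.id ℝ E := by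
  have h := comp_fderiv_eq_id_of_leftInvOn (hasFDerivAt_id z₀) (h := φ) (H' := D)
    (by simpa using hφ) hs hz₀ (by simpa using heq)
  simpa using h

variable [FiniteDimensional ℝ E]

/-- In finite dimension a continuous linear map with a left inverse is invertible: the
continuous linear equivalence with the same action. [folklore] -/
noncomputable def linearEquivOfLeftInverse (G H' : E →L[ℝ] E)
    (h : H'.comp G = ContinuousLinearMap.id ℝ E) : E ≃L[ℝ] E :=
  LinearEquiv.toContinuousLinearEquiv
    (LinearEquiv.ofBijective G.toLinearMap ⟨fun x y hxy => by
      have := congrArg H' hxy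
      simpa [← ContinuousLinearMap.comp_apply, h] using this,
      LinearMap.surjective_of_injective (f := G.toLinearMap) fun x y hxy => by
        have := congrArg H' hxy
        simpa [← ContinuousLinearMap.comp_apply, h] using this⟩)

/-- The equivalence acts as the given map. [folklore] -/
@[simp] theorem linearEquivOfLeftInverse_apply (G H' : E →L[ℝ] E)
    (h : H'.comp G = ContinuousLinearMap.id ℝ E) (x : E) :
    linearEquivOfLeftInverse G H' h x = G x := rfl

/-- The equivalence coerces to the given continuous linear map. [folklore] -/
@[simp] theorem coe_linearEquivOfLeftInverse (G H' : E →L[ℝ] E)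
    (h : H'.comp G = ContinuousLinearMap.id ℝ E) :
    (linearEquivOfLeftInverse G H' h : E →L[ℝ] E) = G := by
  ext x; rfl

end DerivUnique


section LocalInverse

variable {E : Type*} [NormedAddCommGroup E] [NormedSpace ℝ E] [CompleteSpace E]

/-- **Inverse function theorem, chart form.** A map `φ`, `C^∞` on an open set `U ∋ z₀` with
invertible derivative at `z₀`, restricts near `z₀` to an open partial homeomorphism `Φ` of `E`
(`Φ = φ` as functions) which is `C^∞` with `C^∞` inverse (restrict Mathlib's
`ContDiffAt.toOpenPartialHomeomorph` to where the derivative stays invertible). [folklore] -/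
theorem exists_openPartialHomeomorph_of_hasFDerivAt {φ : E → E} {U : Set E} (hU : IsOpen U)
    {z₀ : E} (hz₀ : z₀ ∈ U) (hφ : ContDiffOn ℝ ∞ φ U) (e : E ≃L[ℝ] E)
    (he : HasFDerivAt φ (e : E →L[ℝ] E) z₀) :
    ∃ Φ : OpenPartialHomeomorph E E, z₀ ∈ Φ.source ∧ Φ.source ⊆ U ∧ (∀ z, Φ z = φ z) ∧
      ContDiffOn ℝ ∞ Φ Φ.source ∧ ContDiffOn ℝ ∞ Φ.symm Φ.target := by
  have htop : (∞ : ℕ∞ω) ≠ 0 := by simp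
  have hφAt : ContDiffAt ℝ ∞ φ z₀ := hφ.contDiffAt (hU.mem_nhds hz₀)
  set Φ₀ := hφAt.toOpenPartialHomeomorph φ he htop with hΦ₀
  set D : Set E := U ∩ (fderiv ℝ φ) ⁻¹' range ((↑) : (E ≃L[ℝ] E) → E →L[ℝ] E) with hD
  have hDo : IsOpen D :=
    (hφ.continuousOn_fderiv_of_isOpen hU (by simp)).isOpen_inter_preimage hU
      ContinuousLinearEquiv.isOpen
  have hz₀D : z₀ ∈ D := ⟨hz₀, ⟨e, by rw [he.fderiv]⟩⟩
  set Φ := Φ₀.restrOpen D hDo with hΦ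
  have hΦcoe : ∀ z, Φ z = φ z := fun z => rfl
  refine ⟨Φ, ⟨hφAt.mem_toOpenPartialHomeomorph_source he htop, hz₀D⟩, fun z hz => hz.2.1, hΦcoe,
    (hφ.mono fun z hz => hz.2.1).congr fun z _ => hΦcoe z, ?_⟩
  intro y hy
  have hx : Φ.symm y ∈ Φ.source := Φ.map_target hy
  obtain ⟨e', he'⟩ := hx.2.2
  have hcd : ContDiffAt ℝ ∞ Φ (Φ.symm y) := hφ.contDiffAt (hU.mem_nhds hx.2.1)
  have hder : HasFDerivAt Φ (e' : E →L[ℝ] E) (Φ.symm y) := by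
    rw [he']; exact (hcd.differentiableAt (by simp)).hasFDerivAt
  exact (Φ.contDiffAt_symm hy hder hcd).contDiffWithinAt

end LocalInverse




/-! ### §2 Two-sided charts and bicollar charts -/

section TwoSidedChart

variable {k : ℕ}

/-- The boundary charts of the half space send boundary points to boundary points: if
`x₀ 0 = 0` then `(ψ x₀) 0 = 0` for `ψ` in the maximal atlas. [folklore] -/
theorem apply_zero_eq_zero_of_mem_maximalAtlas {ψ : OpenPartialHomeomorph (ℍ (k + 1)) (ℍ (k + 1))}
    (hψ : ψ ∈ IsManifold.maximalAtlas (𝓡∂ (k + 1)) ∞ (ℍ (k + 1))) {x₀ : ℍ (k + 1)}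
    (hx₀ : x₀ ∈ ψ.source) (h0 : x₀.val 0 = 0) : (ψ x₀).val 0 = 0 := by
  have hb : (𝓡∂ (k + 1)).IsBoundaryPoint x₀ := by
    rw [ModelWithCorners.isBoundaryPoint_iff, extChartAt_self_apply,
      frontier_range_modelWithCornersEuclideanHalfSpace]
    exact h0.symm
  have h := (isBoundaryPoint_iff_of_mem_maximalAtlas (by simp) hψ hx₀).1 hb
  rw [OpenPartialHomeomorph.extend_coe, Function.comp_apply,
    frontier_range_modelWithCornersEuclideanHalfSpace] at h
  exact h.symm

/-- **Two-sided extension of a boundary chart of the half space.** For a chart `ψ` of the maximal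
`C^∞` atlas of the closed half space `ℝᵏ⁺¹₊` and a point `x₀ ∈ ψ.source` (of interest: a point
of the boundary hyperplane), the chart written in the model, `z ↦ ψ z` (a `C^∞` map of a relatively open piece of the
half space onto another, in the within sense), extends to a `C^∞` diffeomorphism `𝓖` between open
subsets of `ℝᵏ⁺¹` around `x₀`: `𝓖 x = ψ x` for points `x` of the half space in `𝓖.source`. (Extend
`ψ` and `ψ⁻¹` across the hyperplane by Seeley's theorem; `ψ⁻¹ ∘ ψ = id` on the half space forces the
derivative of the extension at `x₀` to be invertible, whence a local diffeomorphism by the inverse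
function theorem.) [cite: Seeley1964, Theorem] -/
theorem exists_twoSided_chart {ψ : OpenPartialHomeomorph (ℍ (k + 1)) (ℍ (k + 1))}
    (hψ : ψ ∈ IsManifold.maximalAtlas (𝓡∂ (k + 1)) ∞ (ℍ (k + 1))) {x₀ : ℍ (k + 1)}
    (hx₀ : x₀ ∈ ψ.source) :
    ∃ 𝓖 : OpenPartialHomeomorph (𝔼 (k + 1)) (𝔼 (k + 1)), x₀.val ∈ 𝓖.source ∧
      ContDiffOn ℝ ∞ 𝓖 𝓖.source ∧ ContDiffOn ℝ ∞ 𝓖.symm 𝓖.target ∧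
      ∀ x : ℍ (k + 1), x.val ∈ 𝓖.source → x ∈ ψ.source ∧ 𝓖 x.val = (ψ x).val := by
  set I := (𝓡∂ (k + 1)) with hI
  have htop : (∞ : ℕ∞ω) ≠ 0 := by simp
  -- the chart written in the model and its inverse
  set g := I.extendCoordChange (OpenPartialHomeomorph.refl _) ψ with hgdef
  have hrefl : OpenPartialHomeomorph.refl (ℍ (k + 1)) ∈ IsManifold.maximalAtlas I ∞ (ℍ (k + 1)) :=
    IsManifold.subset_maximalAtlas (by simp)
  have hg : ContDiffOn ℝ ∞ g g.source := I.contDiffOn_extendCoordChange hrefl hψ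
  have hginv : ContDiffOn ℝ ∞ g.symm g.target := I.contDiffOn_extendCoordChange_symm hrefl hψ
  have hrange : range I = {z : 𝔼 (k + 1) | 0 ≤ z 0} := range_modelWithCornersEuclideanHalfSpace _
  have hg_apply : ∀ z, g z = (ψ (I.symm z)).val := fun z => rfl
  have hgsymm_apply : ∀ z, g.symm z = (ψ.symm (I.symm z)).val := fun z => rfl
  have hsrc : g.source = I.symm ⁻¹' ψ.source ∩ range I := by
    rw [hgdef, ModelWithCorners.extendCoordChange_source, OpenPartialHomeomorph.refl_symm,
      OpenPartialHomeomorph.refl_trans, I.image_eq]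
  have htgt : g.target = I.symm ⁻¹' ψ.target ∩ range I := by
    rw [hgdef, ModelWithCorners.extendCoordChange_target, OpenPartialHomeomorph.refl_symm,
      OpenPartialHomeomorph.refl_trans, I.image_eq]
  set U : Set (𝔼 (k + 1)) := I.symm ⁻¹' ψ.source with hU
  set U' : Set (𝔼 (k + 1)) := I.symm ⁻¹' ψ.target with hU'
  have hUo : IsOpen U := ψ.open_source.preimage I.continuous_symm
  have hU'o : IsOpen U' := ψ.open_target.preimage I.continuous_symm
  set z₀ : 𝔼 (k + 1) := x₀.val with hz₀
  set z₁ : 𝔼 (k + 1) := (ψ x₀).val with hz₁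
  have hIz₀ : I.symm z₀ = x₀ := I.left_inv x₀
  have hIz₁ : I.symm z₁ = ψ x₀ := I.left_inv (ψ x₀)
  have hz₀U : z₀ ∈ U := by rw [hU, Set.mem_preimage, hIz₀]; exact hx₀
  have hz₁U' : z₁ ∈ U' := by rw [hU', Set.mem_preimage, hIz₁]; exact ψ.map_source hx₀
  have hz₀r : z₀ ∈ range I := ⟨x₀, rfl⟩
  have hgz₀ : g z₀ = z₁ := by rw [hg_apply, hIz₀]
  -- Seeley: two-sided extensions of `g` near `z₀` and of `g.symm` near `z₁`
  obtain ⟨V₁, hV₁o, hz₀V₁, hV₁U, ĝ, hĝ, hĝg⟩ := exists_contDiffOn_extension_halfSpace hUo hz₀U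
    (f := g) (by rw [← hrange, ← hsrc]; exact hg)
  obtain ⟨V₂, hV₂o, hz₁V₂, hV₂U', ĥ, hĥ, hĥg⟩ := exists_contDiffOn_extension_halfSpace hU'o hz₁U'
    (f := g.symm) (by rw [← hrange, ← htgt]; exact hginv)
  -- `ĥ ∘ ĝ = id` on the half space near `z₀`
  have hĝz₀ : ĝ z₀ = z₁ := by rw [hĝg ⟨hz₀V₁, x₀.2⟩, hgz₀]
  have heq : ∀ᶠ z in 𝓝[range I] z₀, ĥ (ĝ z) = z := by
    have hcont : ContinuousWithinAt g g.source z₀ := hg.continuousOn.continuousWithinAt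
      (by rw [hsrc]; exact ⟨hz₀U, hz₀r⟩)
    have h1 : ∀ᶠ z in 𝓝[g.source] z₀, g z ∈ V₂ :=
      hcont.tendsto (hV₂o.mem_nhds (by rw [hgz₀]; exact hz₁V₂))
    rw [hsrc, nhdsWithin_inter_of_mem (mem_nhdsWithin_of_mem_nhds (hUo.mem_nhds hz₀U))] at h1
    filter_upwards [h1, mem_nhdsWithin_of_mem_nhds (hV₁o.mem_nhds hz₀V₁),
      mem_nhdsWithin_of_mem_nhds (hUo.mem_nhds hz₀U), self_mem_nhdsWithin] with z hzV₂ hzV₁ hzU hzr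
    have hzr' : 0 ≤ z 0 := by rw [hrange] at hzr; exact hzr
    have hgz : ĝ z = g z := hĝg ⟨hzV₁, hzr'⟩
    have hgzr : 0 ≤ g z 0 := by rw [hg_apply]; exact (ψ (I.symm z)).2
    rw [hgz, hĥg ⟨hzV₂, hgzr⟩]
    exact g.left_inv (by rw [hsrc]; exact ⟨hzU, hzr⟩)
  -- derivatives
  have hĝAt : ContDiffAt ℝ ∞ ĝ z₀ := hĝ.contDiffAt (hV₁o.mem_nhds hz₀V₁)
  have hĥAt : ContDiffAt ℝ ∞ ĥ (ĝ z₀) := by rw [hĝz₀]; exact hĥ.contDiffAt (hV₂o.mem_nhds hz₁V₂)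
  have hdĝ : HasFDerivAt ĝ (fderiv ℝ ĝ z₀) z₀ := (hĝAt.differentiableAt (by simp)).hasFDerivAt
  have hdĥ : HasFDerivAt ĥ (fderiv ℝ ĥ (ĝ z₀)) (ĝ z₀) := (hĥAt.differentiableAt (by simp)).hasFDerivAt
  have hcomp := comp_fderiv_eq_id_of_leftInvOn hdĝ hdĥ (I.uniqueDiffOn z₀ hz₀r) hz₀r heq
  set G' := linearEquivOfLeftInverse _ _ hcomp with hG'
  have hdĝ' : HasFDerivAt ĝ (G' : 𝔼 (k + 1) →L[ℝ] 𝔼 (k + 1)) z₀ := by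
    rw [hG', coe_linearEquivOfLeftInverse]; exact hdĝ
  -- the local diffeomorphism, restricted to where the derivative stays invertible
  set 𝓖₀ := hĝAt.toOpenPartialHomeomorph ĝ hdĝ' htop with h𝓖₀
  set D : Set (𝔼 (k + 1)) := V₁ ∩ (fderiv ℝ ĝ) ⁻¹'
    range ((↑) : (𝔼 (k + 1) ≃L[ℝ] 𝔼 (k + 1)) → 𝔼 (k + 1) →L[ℝ] 𝔼 (k + 1)) with hD
  have hDo : IsOpen D :=
    (hĝ.continuousOn_fderiv_of_isOpen hV₁o (by simp)).isOpen_inter_preimage hV₁o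
      ContinuousLinearEquiv.isOpen
  have hz₀D : z₀ ∈ D := ⟨hz₀V₁, ⟨G', by rw [hdĝ'.fderiv]⟩⟩
  set O : Set (𝔼 (k + 1)) := D ∩ U with hO
  have hOo : IsOpen O := hDo.inter hUo
  set 𝓖 := 𝓖₀.restrOpen O hOo with h𝓖
  have h𝓖coe : ∀ z, 𝓖 z = ĝ z := fun z => rfl
  have h𝓖src : 𝓖.source = 𝓖₀.source ∩ O := rfl
  refine ⟨𝓖, ⟨hĝAt.mem_toOpenPartialHomeomorph_source hdĝ' htop, hz₀D, hz₀U⟩, ?_, ?_, ?_⟩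
  · -- smooth
    exact (hĝ.mono fun z hz => hz.2.1.1).congr fun z _ => h𝓖coe z
  · -- smooth inverse
    intro y hy
    have hx : 𝓖.symm y ∈ 𝓖.source := 𝓖.map_target hy
    obtain ⟨e, he⟩ := hx.2.1.2
    have hV : 𝓖.symm y ∈ V₁ := hx.2.1.1
    have hcd : ContDiffAt ℝ ∞ 𝓖 (𝓖.symm y) := hĝ.contDiffAt (hV₁o.mem_nhds hV)
    have hder : HasFDerivAt 𝓖 (e : 𝔼 (k + 1) →L[ℝ] 𝔼 (k + 1)) (𝓖.symm y) := by
      rw [he]; exact (hcd.differentiableAt (by simp)).hasFDerivAt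
    exact (𝓖.contDiffAt_symm hy hder hcd).contDiffWithinAt
  · -- agreement with `ψ` on the half space
    intro x hx
    have hIx : I.symm x.val = x := I.left_inv x
    have hxU : x.val ∈ U := hx.2.2
    have hxψ : x ∈ ψ.source := by
      have := hxU; rw [hU, Set.mem_preimage, hIx] at this; exact this
    refine ⟨hxψ, ?_⟩
    rw [h𝓖coe, hĝg ⟨hx.2.1.1, x.2⟩, hg_apply, hIx]

/-- **The bicollar chart of a boundary point of an immersed half space.** Let
`G : ℝᵏ⁺¹₊ → X` be a `C^∞` immersion (chosen `0`-dimensional complement, i.e. a local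
diffeomorphism onto a codimension-`0` piece with boundary of the boundaryless manifold `X`) at a
point `x₀` (of interest: a point of the boundary hyperplane). Then `G` extends near `x₀` to a
diffeomorphism `K` between an open subset of `ℝᵏ⁺¹` around `x₀` and an open subset of `X`:
`K x = G x` for points `x` of the half space in `K.source`. (In the immersion charts of `G` the
image of the half space is flat, and `G` becomes a boundary chart of the half space, extended
two-sidedly by `exists_twoSided_chart`.) This is the local bicollar of the seam used to make
gluing witnesses seam-adapted (Hirsch, *Differential Topology*, Ch. 8, proof of Thm. 1.9).
[cite: Seeley1964, Theorem] -/
theorem exists_bicollarChart {X : Type*} [TopologicalSpace X] [ChartedSpace (𝔼 (k + 1)) X]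
    [IsManifold (𝓡 (k + 1)) ∞ X] {G : ℍ (k + 1) → X} {x₀ : ℍ (k + 1)}
    (hG : Manifold.IsImmersionAtOfComplement Unit (𝓡∂ (k + 1)) (𝓡 (k + 1)) ∞ G x₀) :
    ∃ K : OpenPartialHomeomorph (𝔼 (k + 1)) X, x₀.val ∈ K.source ∧
      ContMDiffOn 𝓘(ℝ, 𝔼 (k + 1)) (𝓡 (k + 1)) ∞ K K.source ∧
      ContMDiffOn (𝓡 (k + 1)) 𝓘(ℝ, 𝔼 (k + 1)) ∞ K.symm K.target ∧
      ∀ x : ℍ (k + 1), x.val ∈ K.source → K x.val = G x := by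
  set I := (𝓡∂ (k + 1)) with hI
  set ψ := hG.domChart with hψdef
  set χ := hG.codChart with hχdef
  have hψ : ψ ∈ IsManifold.maximalAtlas I ∞ (ℍ (k + 1)) := hG.domChart_mem_maximalAtlas
  have hχ : χ ∈ IsManifold.maximalAtlas (𝓡 (k + 1)) ∞ X := hG.codChart_mem_maximalAtlas
  -- the linear normal form `z ↦ L (z, 0)`
  set Λ : 𝔼 (k + 1) ≃L[ℝ] 𝔼 (k + 1) :=
    (ContinuousLinearEquiv.prodUnique ℝ (𝔼 (k + 1)) Unit).symm.trans hG.equiv with hΛ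
  have hΛ_apply : ∀ z, Λ z = hG.equiv (z, ()) := fun z => rfl
  -- `χ ∘ G ∘ ψ⁻¹ = Λ` on the model image of `ψ.target`
  have hwritten : ∀ x : ℍ (k + 1), x ∈ ψ.target → χ (G (ψ.symm x)) = Λ x.val := by
    intro x hx
    have hmem : x.val ∈ (ψ.extend I).target := by
      rw [OpenPartialHomeomorph.extend_target]
      refine ⟨?_, ⟨x, rfl⟩⟩
      show I.symm x.val ∈ ψ.target
      rw [show I.symm x.val = x from I.left_inv x]; exact hx
    have h := hG.writtenInCharts hmem
    simp only [Function.comp_apply, OpenPartialHomeomorph.extend_coe,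
      OpenPartialHomeomorph.extend_coe_symm, modelWithCornersSelf_coe, id_eq] at h
    rw [show I.symm x.val = x from I.left_inv x] at h
    rw [hΛ_apply]; exact h
  -- the two-sided extension of `ψ`
  obtain ⟨𝓖, hx₀𝓖, h𝓖, h𝓖symm, h𝓖ψ⟩ := exists_twoSided_chart hψ hG.mem_domChart_source
  -- the bicollar chart
  set K : OpenPartialHomeomorph (𝔼 (k + 1)) X := (𝓖.transHomeomorph Λ.toHomeomorph) ≫ₕ χ.symm
    with hK
  have hK_apply : ∀ z, K z = χ.symm (Λ (𝓖 z)) := fun z => rfl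
  have hKsymm_apply : ∀ p, K.symm p = 𝓖.symm (Λ.symm (χ p)) := fun p => rfl
  have hKsrc : ∀ z, z ∈ K.source ↔ z ∈ 𝓖.source ∧ Λ (𝓖 z) ∈ χ.target := fun z => Iff.rfl
  have hKtgt : ∀ p, p ∈ K.target ↔ p ∈ χ.source ∧ Λ.symm (χ p) ∈ 𝓖.target := fun p => Iff.rfl
  have hGx₀ : G x₀ ∈ χ.source := hG.mem_codChart_source
  refine ⟨K, ?_, ?_, ?_, ?_⟩
  · -- `x₀ ∈ K.source`
    refine (hKsrc _).2 ⟨hx₀𝓖, ?_⟩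
    rw [(h𝓖ψ x₀ hx₀𝓖).2, ← hwritten (ψ x₀) (ψ.map_source hG.mem_domChart_source),
      ψ.left_inv hG.mem_domChart_source]
    exact χ.map_source hGx₀
  · -- smooth
    have h1 : ContMDiffOn 𝓘(ℝ, 𝔼 (k + 1)) 𝓘(ℝ, 𝔼 (k + 1)) ∞ 𝓖 𝓖.source := h𝓖.contMDiffOn
    have h2 : ContMDiff 𝓘(ℝ, 𝔼 (k + 1)) (𝓡 (k + 1)) ∞ (Λ : 𝔼 (k + 1) → 𝔼 (k + 1)) :=
      Λ.contDiff.contMDiff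
    have h3 : ContMDiffOn (𝓡 (k + 1)) (𝓡 (k + 1)) ∞ χ.symm χ.target :=
      contMDiffOn_symm_of_mem_maximalAtlas hχ
    have h23 : ContMDiffOn 𝓘(ℝ, 𝔼 (k + 1)) (𝓡 (k + 1)) ∞ (χ.symm ∘ Λ) (Λ ⁻¹' χ.target) :=
      h3.comp h2.contMDiffOn fun z hz => hz
    exact (h23.comp (h1.mono fun z hz => ((hKsrc z).1 hz).1) fun z hz => ((hKsrc z).1 hz).2).congr
      fun z _ => hK_apply z
  · -- smooth inverse
    have h1 : ContMDiffOn 𝓘(ℝ, 𝔼 (k + 1)) 𝓘(ℝ, 𝔼 (k + 1)) ∞ 𝓖.symm 𝓖.target :=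
      h𝓖symm.contMDiffOn
    have h2 : ContMDiff (𝓡 (k + 1)) 𝓘(ℝ, 𝔼 (k + 1)) ∞ (Λ.symm : 𝔼 (k + 1) → 𝔼 (k + 1)) :=
      Λ.symm.contDiff.contMDiff
    have h3 : ContMDiffOn (𝓡 (k + 1)) (𝓡 (k + 1)) ∞ χ χ.source := contMDiffOn_of_mem_maximalAtlas hχ
    have h23 : ContMDiffOn (𝓡 (k + 1)) 𝓘(ℝ, 𝔼 (k + 1)) ∞ (Λ.symm ∘ χ) K.target :=
      (h2.comp_contMDiffOn h3).mono fun p hp => ((hKtgt p).1 hp).1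
    exact (h1.comp h23 fun p hp => ((hKtgt p).1 hp).2).congr fun p _ => hKsymm_apply p
  · -- agreement with `G` on the half space
    intro x hx
    have hx𝓖 : x.val ∈ 𝓖.source := ((hKsrc _).1 hx).1
    obtain ⟨hxψ, h𝓖x⟩ := h𝓖ψ x hx𝓖
    rw [hK_apply, h𝓖x, ← hwritten (ψ x) (ψ.map_source hxψ), ψ.left_inv hxψ,
      χ.left_inv (hG.source_subset_preimage_source hxψ)]

end TwoSidedChart

/-! ### §3 Seam charts, their collapse, and the global bicollar -/

section SeamCharts

open Set Metric Module

variable {k : ℕ} {A X : Type*} [TopologicalSpace A] [ChartedSpace (ℍ (k + 1)) A]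
  [IsManifold (𝓡∂ (k + 1)) ∞ A]
  [TopologicalSpace X] [ChartedSpace (𝔼 (k + 1)) X] [IsManifold (𝓡 (k + 1)) ∞ X]
  {jA : A → X} {kA : ℍ (k + 1) → A}

/-- **Seam charts.** Let `jA : A ↪ X` be a `C^∞` embedding of a manifold with boundary into a
boundaryless manifold of the same dimension and `kA : ℝᵏ⁺¹₊ ↪ A` a `C^∞` embedding of the closed
half space with open range (a half-disc of `A` resting on `∂A`). Around every point `x₀` of the
half space, and inside any prescribed ball, `jA ∘ kA` extends across the boundary hyperplane to a
diffeomorphism `K` of an open subset of `ℝᵏ⁺¹` onto an open subset of `X` which moreover sees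
`jA(A)` exactly from above: a point `K z` of the source lies in `jA(A)` only if `z 0 ≥ 0`. (The
bicollar chart `exists_bicollarChart`, shrunk so that its image meets `jA(A)` inside the
relatively open set `jA(kA(U))`.) Local form of the bicollaring of the seam of a gluing
(Hirsch, *Differential Topology*, Ch. 8, proof of Thm. 1.9).
[cite: HirschDT1976, Ch. 8 §1, proof of Thm. 1.9 (with Thm. 1.8), pp. 181–182] -/
theorem exists_seamChart (hjA : Manifold.IsSmoothEmbedding (𝓡∂ (k + 1)) (𝓡 (k + 1)) ∞ jA)
    (hkA : Manifold.IsSmoothEmbedding (𝓡∂ (k + 1)) (𝓡∂ (k + 1)) ∞ kA) (hkAo : IsOpen (range kA))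
    (x₀ : ℍ (k + 1)) {ε : ℝ} (hε : 0 < ε) :
    ∃ K : OpenPartialHomeomorph (𝔼 (k + 1)) X, x₀.val ∈ K.source ∧ K.source ⊆ ball x₀.val ε ∧
      ContMDiffOn 𝓘(ℝ, 𝔼 (k + 1)) (𝓡 (k + 1)) ∞ K K.source ∧
      ContMDiffOn (𝓡 (k + 1)) 𝓘(ℝ, 𝔼 (k + 1)) ∞ K.symm K.target ∧
      (∀ x : ℍ (k + 1), x.val ∈ K.source → K x.val = jA (kA x)) ∧
      (∀ z ∈ K.source, K z ∈ range jA → 0 ≤ z 0) := by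
  haveI : Nonempty (ℍ (k + 1)) := ⟨x₀⟩
  set Φ := openEmbeddingChart hkA hkAo with hΦ
  have hdim : finrank ℝ (𝔼 (k + 1)) + finrank ℝ Unit = finrank ℝ (𝔼 (k + 1)) := by
    rw [Module.finrank_zero_of_subsingleton (M := Unit), add_zero]
  have himm : Manifold.IsImmersionAtOfComplement Unit (𝓡∂ (k + 1)) (𝓡 (k + 1)) ∞ (jA ∘ Φ) x₀ :=
    (hjA.isImmersion.isImmersionOfComplement_of_finrank_eq hdim (Φ x₀)).comp_openPartialHomeomorph
      Φ (contMDiffOn_openEmbeddingChart hkA hkAo) (contMDiffOn_openEmbeddingChart_symm hkA hkAo)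
      (by simp [hΦ])
  obtain ⟨K₀, hx₀, hK₀, hK₀symm, hK₀G⟩ := exists_bicollarChart himm
  -- the relatively open piece `jA (kA U)` of `jA(A)`
  set U : Set (ℍ (k + 1)) := {y | y.val ∈ K₀.source ∩ ball x₀.val ε} with hU
  have hUo : IsOpen U :=
    (K₀.open_source.inter isOpen_ball).preimage continuous_subtype_val
  have hkAU : IsOpen (kA '' U) :=
    (IsOpenEmbedding.mk hkA.isEmbedding hkAo : IsOpenEmbedding kA).isOpenMap U hUo
  obtain ⟨V, hVo, hVU⟩ := hjA.isEmbedding.isInducing.isOpen_iff.1 hkAU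
  -- the shrunk chart
  have hso : IsOpen (ball x₀.val ε ∩ (K₀.source ∩ K₀ ⁻¹' V)) :=
    isOpen_ball.inter (K₀.isOpen_inter_preimage hVo)
  set K := K₀.restrOpen _ hso with hK
  have hKsrc : ∀ z, z ∈ K.source ↔ z ∈ K₀.source ∧ z ∈ ball x₀.val ε ∧ K₀ z ∈ V := by
    intro z
    rw [hK, OpenPartialHomeomorph.restrOpen_source]
    exact ⟨fun h => ⟨h.1, h.2.1, h.2.2.2⟩, fun h => ⟨h.1, h.2.1, h.1, h.2.2⟩⟩
  have hx₀U : x₀ ∈ U := ⟨hx₀, mem_ball_self hε⟩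
  refine ⟨K, ?_, fun z hz => ((hKsrc z).1 hz).2.1, ?_, ?_, ?_, ?_⟩
  · refine (hKsrc _).2 ⟨hx₀, mem_ball_self hε, ?_⟩
    rw [hK₀G x₀ hx₀]
    show Φ x₀ ∈ jA ⁻¹' V
    rw [hVU]; exact ⟨x₀, hx₀U, rfl⟩
  · exact hK₀.mono fun z hz => ((hKsrc z).1 hz).1
  · exact hK₀symm.mono fun y hy => hy.1
  · intro x hx
    exact hK₀G x ((hKsrc _).1 hx).1
  · intro z hz hzA
    obtain ⟨hz₀, -, hzV⟩ := (hKsrc z).1 hz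
    obtain ⟨a, ha⟩ := hzA
    have haV : a ∈ jA ⁻¹' V := by rw [Set.mem_preimage, ha]; exact hzV
    rw [hVU] at haV
    obtain ⟨u, hu, rfl⟩ := haV
    have h1 : K₀ z = K₀ u.val := by rw [hK₀G u hu.1]; exact ha.symm
    rw [K₀.injOn hz₀ hu.1 h1]
    exact u.2

/-- Closed half balls `{‖y‖ ≤ R}` of the closed half space are compact. [folklore] -/
theorem isCompact_halfSpace_norm_le (R : ℝ) : IsCompact {y : ℍ (k + 1) | ‖y.val‖ ≤ R} := by
  have hce : IsClosedEmbedding (fun y : ℍ (k + 1) => y.val) :=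
    IsClosed.isClosedEmbedding_subtypeVal
      (isClosed_le continuous_const (EuclideanSpace.proj (0 : Fin (k + 1))).continuous)
  have : {y : ℍ (k + 1) | ‖y.val‖ ≤ R} =
      (fun y : ℍ (k + 1) => y.val) ⁻¹' closedBall (0 : 𝔼 (k + 1)) R := by
    ext y; simp only [Set.mem_setOf_eq, Set.mem_preimage, mem_closedBall_zero_iff]
  rw [this]
  exact hce.isCompact_preimage (isCompact_closedBall _ _)

/-- **The collapse of a bicollar neighbourhood of a half-disc.** In the situation of
`exists_seamChart`, for `R ≥ 0` there are a `C^∞` map `c : X → ℝᵏ⁺¹` and an open set `Ω ⊆ X`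
containing `jA (kA y)` for `‖y‖ < R + 1` such that: `c (jA (kA y)) = y` for `‖y‖ ≤ R + 2`; every
point of `Ω ∩ jA(A)` is `jA (kA y)` for some `‖y‖ < R + 2`; at points of `Ω` off `jA(A)` the height
`(c p) 0` is negative (or `c p = 0`); and `c` has `C^∞` local sections through every point of `Ω`.
(`c` is the average `∑ ρ_x • K_x⁻¹` of the inverses of seam charts over a smooth partition of
unity; all of them invert `jA ∘ kA` above the seam, so `c ∘ K_x = id` on the upper half space near
`x`, whence `D(c ∘ K_x)(x) = id` and `c ∘ K_x` is a local diffeomorphism.) This is the patching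
step of the bicollaring of the seam (Hirsch, *Differential Topology*, Ch. 8, proof of Thm. 1.9;
Munkres, *Elementary Differential Topology*, §6).
[cite: HirschDT1976, Ch. 8 §1, proof of Thm. 1.9 (with Thm. 1.8), pp. 181–182] -/
theorem exists_seamCollapse [T2Space X] [SecondCountableTopology X]
    (hjA : Manifold.IsSmoothEmbedding (𝓡∂ (k + 1)) (𝓡 (k + 1)) ∞ jA)
    (hkA : Manifold.IsSmoothEmbedding (𝓡∂ (k + 1)) (𝓡∂ (k + 1)) ∞ kA) (hkAo : IsOpen (range kA))
    (R : ℝ) :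
    ∃ (c : X → 𝔼 (k + 1)) (Ω : Set X), ContMDiff (𝓡 (k + 1)) 𝓘(ℝ, 𝔼 (k + 1)) ∞ c ∧ IsOpen Ω ∧
      (∀ y : ℍ (k + 1), ‖y.val‖ ≤ R + 2 → c (jA (kA y)) = y.val) ∧
      (∀ y : ℍ (k + 1), ‖y.val‖ < R + 1 → jA (kA y) ∈ Ω) ∧
      (∀ p ∈ Ω, p ∈ range jA → ∃ y : ℍ (k + 1), ‖y.val‖ < R + 2 ∧ p = jA (kA y)) ∧
      (∀ p ∈ Ω, p ∉ range jA → c p 0 < 0 ∨ c p = 0) ∧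
      (∀ p ∈ Ω, ∃ Ψ : OpenPartialHomeomorph (𝔼 (k + 1)) X, p ∈ Ψ.target ∧ Ψ.target ⊆ Ω ∧
        ContMDiffOn 𝓘(ℝ, 𝔼 (k + 1)) (𝓡 (k + 1)) ∞ Ψ Ψ.source ∧ ∀ q ∈ Ψ.source, c (Ψ q) = q) := by
  classical
  set G : ℍ (k + 1) → X := fun y => jA (kA y) with hG
  have hGinj : Function.Injective G := hjA.isEmbedding.injective.comp hkA.isEmbedding.injective
  have hGcont : Continuous G := hjA.isEmbedding.continuous.comp hkA.isEmbedding.continuous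
  -- seam charts of radius `1` around every point
  choose K hK using fun x : ℍ (k + 1) => exists_seamChart hjA hkA hkAo x one_pos
  have hKsrc := fun x => (hK x).1
  have hKball := fun x => (hK x).2.1
  have hKsm := fun x => (hK x).2.2.1
  have hKsymm := fun x => (hK x).2.2.2.1
  have hKG := fun x => (hK x).2.2.2.2.1
  have hKrange := fun x => (hK x).2.2.2.2.2
  -- inverting `G` above the seam
  have hKinv : ∀ x (y : ℍ (k + 1)), G y ∈ (K x).target → (K x).symm (G y) = y.val := by
    intro x y hy
    set z := (K x).symm (G y) with hz
    have hzs : z ∈ (K x).source := (K x).map_target hy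
    have hKz : K x z = G y := (K x).right_inv hy
    have hz0 : 0 ≤ z 0 := hKrange x z hzs (hKz ▸ ⟨kA y, rfl⟩)
    have h1 : G ⟨z, hz0⟩ = G y := by rw [← hKz, hKG x ⟨z, hz0⟩ hzs]
    exact congrArg Subtype.val (hGinj h1)
  -- the compact piece of `G(ℝᵏ⁺¹₊)` over the closed half ball of radius `R + 2`
  set Fc : Set (ℍ (k + 1)) := {y | ‖y.val‖ ≤ R + 2} with hFc
  have hFc_cpt : IsCompact Fc := isCompact_halfSpace_norm_le (R + 2)
  set s : Set X := G '' Fc with hs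
  have hs_closed : IsClosed s := (hFc_cpt.image hGcont).isClosed
  have hcover : s ⊆ ⋃ x, (K x).target := by
    rintro _ ⟨y, -, rfl⟩
    refine mem_iUnion.2 ⟨y, ?_⟩
    rw [show G y = K y y.val from (hKG y y (hKsrc y)).symm]
    exact (K y).map_source (hKsrc y)
  -- a smooth partition of unity subordinate to the targets of the seam charts
  haveI : LocallyCompactSpace X := ChartedSpace.locallyCompactSpace (𝔼 (k + 1)) X
  obtain ⟨ρ, hρ⟩ := SmoothPartitionOfUnity.exists_isSubordinate (I := 𝓡 (k + 1)) hs_closed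
    (fun x => (K x).target) (fun x => (K x).open_target) hcover
  -- the collapse
  set c : X → 𝔼 (k + 1) := fun p => ∑ᶠ x, ρ x p • (K x).symm p with hc
  have hc_smooth : ContMDiff (𝓡 (k + 1)) 𝓘(ℝ, 𝔼 (k + 1)) ∞ c :=
    hρ.contMDiff_finsum_smul (fun x => (K x).open_target) fun x => hKsymm x
  have hcG : ∀ y : ℍ (k + 1), ‖y.val‖ ≤ R + 2 → c (G y) = y.val := by
    intro y hy
    have hys : G y ∈ s := mem_image_of_mem G hy
    have key : ∀ x, ρ x (G y) • (K x).symm (G y) = ρ x (G y) • y.val := by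
      intro x
      by_cases h : ρ x (G y) = 0
      · rw [h, zero_smul, zero_smul]
      · have hmem : G y ∈ (K x).target :=
          hρ x (subset_tsupport _ (Function.mem_support.2 h))
        rw [hKinv x y hmem]
    show ∑ᶠ x, ρ x (G y) • (K x).symm (G y) = y.val
    rw [finsum_congr key, ← finsum_smul, ρ.sum_eq_one hys, one_smul]
  -- local sections of `c` through `G x`, `‖x‖ < R + 2`
  have hloc : ∀ x : ℍ (k + 1), ‖x.val‖ < R + 2 → ∃ Ψ : OpenPartialHomeomorph (𝔼 (k + 1)) X,
      G x ∈ Ψ.target ∧ Ψ.target ⊆ (K x).target ∧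
      ContMDiffOn 𝓘(ℝ, 𝔼 (k + 1)) (𝓡 (k + 1)) ∞ Ψ Ψ.source ∧ ∀ q ∈ Ψ.source, c (Ψ q) = q := by
    intro x hx
    set φ : 𝔼 (k + 1) → 𝔼 (k + 1) := c ∘ K x with hφ
    have hφU : ContDiffOn ℝ ∞ φ (K x).source :=
      contMDiffOn_iff_contDiffOn.1 (hc_smooth.comp_contMDiffOn (hKsm x))
    -- `φ = id` on the upper half space near `x`
    have hφid : ∀ᶠ z in 𝓝[{z | 0 ≤ z 0}] x.val, φ z = z := by
      have hn : (K x).source ∩ ball (0 : 𝔼 (k + 1)) (R + 2) ∈ 𝓝 x.val :=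
        ((K x).open_source.inter isOpen_ball).mem_nhds ⟨hKsrc x, mem_ball_zero_iff.2 hx⟩
      filter_upwards [mem_nhdsWithin_of_mem_nhds hn, self_mem_nhdsWithin] with z hz hz0
      have h1 : K x z = G ⟨z, hz0⟩ := hKG x ⟨z, hz0⟩ hz.1
      show c (K x z) = z
      rw [h1, hcG ⟨z, hz0⟩ (mem_ball_zero_iff.1 hz.2).le]
    have hφAt : ContDiffAt ℝ ∞ φ x.val := hφU.contDiffAt ((K x).open_source.mem_nhds (hKsrc x))
    have hdφ : HasFDerivAt φ (fderiv ℝ φ x.val) x.val :=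
      (hφAt.differentiableAt (by simp)).hasFDerivAt
    have hUD : UniqueDiffOn ℝ {z : 𝔼 (k + 1) | 0 ≤ z 0} := by
      rw [← range_modelWithCornersEuclideanHalfSpace (k + 1)]
      exact (𝓡∂ (k + 1)).uniqueDiffOn
    have hD : fderiv ℝ φ x.val = ContinuousLinearMap.id ℝ _ :=
      fderiv_eq_id_of_eventuallyEq hdφ (hUD x.val x.2) x.2 hφid
    have hdφ' : HasFDerivAt φ ((ContinuousLinearEquiv.refl ℝ (𝔼 (k + 1)) :
        𝔼 (k + 1) →L[ℝ] 𝔼 (k + 1))) x.val := by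
      rw [ContinuousLinearEquiv.coe_refl, ← hD]; exact hdφ
    obtain ⟨Φ, hxΦ, hΦsrc, hΦφ, hΦsm, hΦsymm⟩ :=
      exists_openPartialHomeomorph_of_hasFDerivAt (K x).open_source (hKsrc x) hφU _ hdφ'
    refine ⟨Φ.symm ≫ₕ K x, ?_, ?_, ?_, ?_⟩
    · -- `G x = (Φ.symm ≫ K x) (Φ x)`
      have h1 : Φ x.val ∈ (Φ.symm ≫ₕ K x).source := by
        refine ⟨Φ.map_source hxΦ, ?_⟩
        show Φ.symm (Φ x.val) ∈ (K x).source
        rw [Φ.left_inv hxΦ]; exact hKsrc x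
      have h2 : (Φ.symm ≫ₕ K x) (Φ x.val) = G x := by
        show K x (Φ.symm (Φ x.val)) = G x
        rw [Φ.left_inv hxΦ, hKG x x (hKsrc x)]
      rw [← h2]; exact OpenPartialHomeomorph.map_source _ h1
    · rw [OpenPartialHomeomorph.trans_target]; exact inter_subset_left
    · rw [OpenPartialHomeomorph.trans_source]
      refine (hKsm x).comp (hΦsymm.contMDiffOn.mono inter_subset_left) fun q hq => hq.2
    · intro q hq
      rw [OpenPartialHomeomorph.trans_source] at hq
      show c (K x (Φ.symm q)) = q
      have : c (K x (Φ.symm q)) = Φ (Φ.symm q) := by rw [hΦφ]; rfl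
      rw [this, Φ.right_inv hq.1]
  choose Ψ hΨ using hloc
  -- the open set `Ω`
  set Ω : Set X := ⋃ (x : ℍ (k + 1)) (h : ‖x.val‖ < R + 1), (Ψ x (by linarith)).target with hΩ
  have hΩo : IsOpen Ω := isOpen_iUnion fun x => isOpen_iUnion fun h => (Ψ x _).open_target
  have hmemΩ : ∀ p, p ∈ Ω ↔ ∃ (x : ℍ (k + 1)) (h : ‖x.val‖ < R + 1),
      p ∈ (Ψ x (by linarith)).target := by
    intro p; simp only [hΩ, mem_iUnion]
  refine ⟨c, Ω, hc_smooth, hΩo, hcG, ?_, ?_, ?_, ?_⟩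
  · -- `G y ∈ Ω` for `‖y‖ < R + 1`
    intro y hy
    exact (hmemΩ _).2 ⟨y, hy, (hΨ y (by linarith)).1⟩
  · -- points of `Ω ∩ jA(A)`
    intro p hp hpA
    obtain ⟨x, hx, hpx⟩ := (hmemΩ p).1 hp
    have hpK : p ∈ (K x).target := (hΨ x (by linarith)).2.1 hpx
    set z := (K x).symm p with hz
    have hzs : z ∈ (K x).source := (K x).map_target hpK
    have hKz : K x z = p := (K x).right_inv hpK
    have hz0 : 0 ≤ z 0 := hKrange x z hzs (hKz ▸ hpA)
    refine ⟨⟨z, hz0⟩, ?_, ?_⟩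
    · have h1 : z ∈ ball x.val 1 := hKball x hzs
      rw [mem_ball] at h1
      calc ‖z‖ = dist z 0 := (dist_zero_right z).symm
        _ ≤ dist z x.val + dist x.val 0 := dist_triangle _ _ _
        _ < 1 + (R + 1) := by rw [dist_zero_right]; exact add_lt_add h1 hx
        _ = R + 2 := by ring
    · rw [← hKz]; exact (hKG x ⟨z, hz0⟩ hzs)
  · -- below the seam the height of the collapse is negative
    intro p hp hpA
    have hfin : (Function.support fun x => ρ x p).Finite := ρ.locallyFinite.point_finite p
    set S := hfin.toFinset with hS
    have hsum : c p = ∑ x ∈ S, ρ x p • (K x).symm p := by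
      apply finsum_eq_sum_of_support_subset
      intro x hx
      rw [Function.mem_support] at hx
      rw [hS, Finset.mem_coe, Set.Finite.mem_toFinset, Function.mem_support]
      exact fun h => hx (by rw [h, zero_smul])
    have hneg : ∀ x ∈ S, (K x).symm p 0 < 0 := by
      intro x hx
      rw [hS, Set.Finite.mem_toFinset, Function.mem_support] at hx
      have hpK : p ∈ (K x).target := hρ x (subset_tsupport _ (Function.mem_support.2 hx))
      have hzs : (K x).symm p ∈ (K x).source := (K x).map_target hpK
      by_contra h
      have hz0 : 0 ≤ (K x).symm p 0 := le_of_not_gt h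
      apply hpA
      rw [← (K x).right_inv hpK, hKG x ⟨_, hz0⟩ hzs]
      exact ⟨_, rfl⟩
    have h0 : c p 0 = ∑ x ∈ S, ρ x p * (K x).symm p 0 := by
      rw [hsum]
      have := map_sum (EuclideanSpace.proj (0 : Fin (k + 1)) (𝕜 := ℝ)) (fun x => ρ x p • (K x).symm p) S
      simp only [map_smul, smul_eq_mul] at this
      exact this
    by_cases hSe : S = ∅
    · right; rw [hsum, hSe, Finset.sum_empty]
    · left
      obtain ⟨x₀, hx₀⟩ := Finset.nonempty_of_ne_empty hSe
      rw [h0, ← Finset.add_sum_erase S _ hx₀]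
      have h1 : ρ x₀ p * (K x₀).symm p 0 < 0 := by
        have hρpos : 0 < ρ x₀ p := by
          have hne : ρ x₀ p ≠ 0 := by
            rw [hS, Set.Finite.mem_toFinset, Function.mem_support] at hx₀; exact hx₀
          exact lt_of_le_of_ne (ρ.nonneg x₀ p) (Ne.symm hne)
        exact mul_neg_of_pos_of_neg hρpos (hneg x₀ hx₀)
      have h2 : ∑ x ∈ S.erase x₀, ρ x p * (K x).symm p 0 ≤ 0 :=
        Finset.sum_nonpos fun x hx =>
          mul_nonpos_of_nonneg_of_nonpos (ρ.nonneg x p) (hneg x (Finset.mem_of_mem_erase hx)).le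
      linarith
  · -- local sections through points of `Ω`
    intro p hp
    obtain ⟨x, hx, hpx⟩ := (hmemΩ p).1 hp
    refine ⟨Ψ x (by linarith), hpx, fun q hq => (hmemΩ q).2 ⟨x, hx, hq⟩,
      (hΨ x (by linarith)).2.2.1, (hΨ x (by linarith)).2.2.2⟩

/-- **Bicollaring the seam along a half-disc.** Let `jA : A ↪ X` be a `C^∞` embedding of a
manifold with boundary into a boundaryless manifold of the same dimension `k + 1`, and
`kA : ℝᵏ⁺¹₊ ↪ A` a `C^∞` embedding of the closed half space with open range. For `r ≥ 0` there is
a diffeomorphism `K` of an open subset of `ℝᵏ⁺¹` containing the closed upper half ball of radius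
`r` onto an open subset of `X`, `C^∞` with `C^∞` inverse, which agrees with `jA ∘ kA` on the
points of the half space in its source and sees `jA(A)` exactly from above (`K z ∈ jA(A)` only if
`z 0 ≥ 0`). This is the bicollaring of the seam `jA(∂A)` along the half-disc (the key step in
showing that gluing witnesses may be taken seam-adapted): invert the collapse
`exists_seamCollapse` on a neighbourhood of `jA (kA {‖y‖ ≤ r})` on which it is injective
(`exists_isOpen_injOn_of_isCompact`). Hirsch, *Differential Topology*, Ch. 8, proof of
Thm. 1.9 (with Thm. 1.8); Munkres, *Elementary Differential Topology*, §6.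
[cite: HirschDT1976, Ch. 8 §1, proof of Thm. 1.9 (with Thm. 1.8), pp. 181–182] -/
theorem exists_seamBicollar [T2Space X] [SecondCountableTopology X]
    (hjA : Manifold.IsSmoothEmbedding (𝓡∂ (k + 1)) (𝓡 (k + 1)) ∞ jA)
    (hkA : Manifold.IsSmoothEmbedding (𝓡∂ (k + 1)) (𝓡∂ (k + 1)) ∞ kA) (hkAo : IsOpen (range kA))
    {r : ℝ} (hr : 0 ≤ r) :
    ∃ K : OpenPartialHomeomorph (𝔼 (k + 1)) X,
      {z : 𝔼 (k + 1) | 0 ≤ z 0 ∧ ‖z‖ ≤ r} ⊆ K.source ∧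
      ContMDiffOn 𝓘(ℝ, 𝔼 (k + 1)) (𝓡 (k + 1)) ∞ K K.source ∧
      ContMDiffOn (𝓡 (k + 1)) 𝓘(ℝ, 𝔼 (k + 1)) ∞ K.symm K.target ∧
      (∀ x : ℍ (k + 1), x.val ∈ K.source → K x.val = jA (kA x)) ∧
      (∀ z ∈ K.source, K z ∈ range jA → 0 ≤ z 0) := by
  classical
  obtain ⟨c, Ω, hc, hΩo, hcG, hGΩ, hΩA, hΩneg, hΩloc⟩ := exists_seamCollapse hjA hkA hkAo r
  set G : ℍ (k + 1) → X := fun y => jA (kA y) with hG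
  have hGinj : Function.Injective G := hjA.isEmbedding.injective.comp hkA.isEmbedding.injective
  have hGcont : Continuous G := hjA.isEmbedding.continuous.comp hkA.isEmbedding.continuous
  haveI : Nonempty X := ⟨G 0⟩
  -- the compact piece to be bicollared
  set K₀ : Set X := G '' {y | ‖y.val‖ ≤ r} with hK₀
  have hK₀cpt : IsCompact K₀ := (isCompact_halfSpace_norm_le r).image hGcont
  have hK₀Ω : K₀ ⊆ Ω := by
    rintro _ ⟨y, hy, rfl⟩; exact hGΩ y (by simp only [Set.mem_setOf_eq] at hy; linarith)
  have hinjK₀ : InjOn c K₀ := by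
    rintro _ ⟨y₁, hy₁, rfl⟩ _ ⟨y₂, hy₂, rfl⟩ h
    simp only [Set.mem_setOf_eq] at hy₁ hy₂
    have h' : y₁.val = y₂.val := by
      rw [← hcG y₁ (by linarith), ← hcG y₂ (by linarith)]; exact h
    rw [Subtype.ext h']
  have hlocinj : ∀ p ∈ K₀, ∃ V ∈ 𝓝 p, InjOn c V := by
    intro p hp
    obtain ⟨Ψ, hpΨ, -, -, hsec⟩ := hΩloc p (hK₀Ω hp)
    refine ⟨Ψ.target, Ψ.open_target.mem_nhds hpΨ, fun p₁ hp₁ p₂ hp₂ h => ?_⟩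
    have h₁ : c p₁ = Ψ.symm p₁ := by
      conv_lhs => rw [← Ψ.right_inv hp₁]
      exact hsec _ (Ψ.map_target hp₁)
    have h₂ : c p₂ = Ψ.symm p₂ := by
      conv_lhs => rw [← Ψ.right_inv hp₂]
      exact hsec _ (Ψ.map_target hp₂)
    rw [← Ψ.right_inv hp₁, ← Ψ.right_inv hp₂, ← h₁, ← h₂, h]
  obtain ⟨W₀, hW₀o, hK₀W₀, hinjW₀⟩ := exists_isOpen_injOn_of_isCompact hK₀cpt
    (fun x _ => hc.continuous.continuousAt) hinjK₀ hlocinj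
  set W : Set X := W₀ ∩ Ω with hW_def
  have hWo : IsOpen W := hW₀o.inter hΩo
  have hK₀W : K₀ ⊆ W := fun x hx => ⟨hK₀W₀ hx, hK₀Ω hx⟩
  have hWΩ : W ⊆ Ω := inter_subset_right
  have hinjW : InjOn c W := hinjW₀.mono inter_subset_left
  -- local sections landing in `W`
  have hsec : ∀ p ∈ W, ∃ (Ψ : OpenPartialHomeomorph (𝔼 (k + 1)) X) (N : Set (𝔼 (k + 1))),
      IsOpen N ∧ c p ∈ N ∧ (∀ q ∈ N, Ψ q ∈ W ∧ c (Ψ q) = q) ∧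
      ContMDiffOn 𝓘(ℝ, 𝔼 (k + 1)) (𝓡 (k + 1)) ∞ Ψ N := by
    intro p hp
    obtain ⟨Ψ, hpΨ, -, hΨsm, hΨsec⟩ := hΩloc p (hWΩ hp)
    refine ⟨Ψ, Ψ.source ∩ Ψ ⁻¹' W, Ψ.isOpen_inter_preimage hWo, ?_, fun q hq =>
      ⟨hq.2, hΨsec q hq.1⟩, hΨsm.mono inter_subset_left⟩
    have h1 : c p = Ψ.symm p := by
      conv_lhs => rw [← Ψ.right_inv hpΨ]
      exact hΨsec _ (Ψ.map_target hpΨ)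
    rw [h1]
    exact ⟨Ψ.map_target hpΨ, show Ψ (Ψ.symm p) ∈ W by rw [Ψ.right_inv hpΨ]; exact hp⟩
  -- the inverse of `c` on `W`
  set e := hinjW.toPartialEquiv c W with he
  have he_symm_apply : ∀ q, e.symm q = Function.invFunOn c W q := fun q => rfl
  have hinv : ∀ q ∈ c '' W, e.symm q ∈ W ∧ c (e.symm q) = q := fun q hq =>
    ⟨e.map_target hq, e.right_inv hq⟩
  have hopen : IsOpen (c '' W) := by
    refine isOpen_iff_mem_nhds.2 ?_
    rintro _ ⟨p, hp, rfl⟩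
    obtain ⟨Ψ, N, hNo, hpN, hN, -⟩ := hsec p hp
    exact mem_of_superset (hNo.mem_nhds hpN) fun q hq => ⟨Ψ q, (hN q hq).1, (hN q hq).2⟩
  have hsmooth : ∀ q ∈ c '' W, ContMDiffAt 𝓘(ℝ, 𝔼 (k + 1)) (𝓡 (k + 1)) ∞ e.symm q := by
    rintro _ ⟨p, hp, rfl⟩
    obtain ⟨Ψ, N, hNo, hpN, hN, hΨsm⟩ := hsec p hp
    have heq : e.symm =ᶠ[𝓝 (c p)] Ψ := by
      filter_upwards [hNo.mem_nhds hpN] with q hq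
      have hq' : q ∈ c '' W := ⟨Ψ q, (hN q hq).1, (hN q hq).2⟩
      exact hinjW (hinv q hq').1 (hN q hq).1 ((hinv q hq').2.trans (hN q hq).2.symm)
    exact ((hΨsm.contMDiffAt (hNo.mem_nhds hpN)).congr_of_eventuallyEq heq :)
  set K : OpenPartialHomeomorph (𝔼 (k + 1)) X :=
    { toPartialEquiv := e.symm
      open_source := hopen
      open_target := hWo
      continuousOn_toFun := fun q hq => (hsmooth q hq).continuousAt.continuousWithinAt
      continuousOn_invFun := hc.continuous.continuousOn } with hK
  have hKsrc : K.source = c '' W := rfl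
  have hG0W : G 0 ∈ W :=
    hK₀W ⟨0, by rw [Set.mem_setOf_eq, show (0 : ℍ (k + 1)).val = 0 from rfl, norm_zero]; exact hr,
      rfl⟩
  -- identification of `K (c p)`, `p ∈ W`
  have hKG : ∀ x : ℍ (k + 1), x.val ∈ K.source → K x.val = G x := by
    intro x hx
    obtain ⟨hpW, hcp⟩ := hinv x.val hx
    set p := e.symm x.val with hp
    have hKp : K x.val = p := rfl
    by_cases hpA : p ∈ range jA
    · obtain ⟨y, hy, hpy⟩ := hΩA p (hWΩ hpW) hpA
      have : y = x := Subtype.ext (by rw [← hcG y hy.le, ← hpy]; exact hcp)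
      rw [hKp, hpy, this]
    · rcases hΩneg p (hWΩ hpW) hpA with h | h
      · have h' : x.val 0 < 0 := by rw [← hcp]; exact h
        exact absurd h' (not_lt.2 x.2)
      · have hx0 : x = 0 := Subtype.ext (by rw [← hcp, h]; rfl)
        have hnorm0 : ‖(0 : ℍ (k + 1)).val‖ ≤ r + 2 := by
          rw [show (0 : ℍ (k + 1)).val = 0 from rfl, norm_zero]; linarith
        have hc0 : c (G 0) = c p := by rw [hcG 0 hnorm0, h]; rfl
        rw [hKp, hx0]; exact hinjW hpW hG0W hc0.symm
  refine ⟨K, ?_, fun q hq => (hsmooth q hq).contMDiffWithinAt, hc.contMDiffOn, hKG, ?_⟩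
  · -- the closed upper half ball of radius `r` lies in the source
    rintro z ⟨hz0, hzr⟩
    refine ⟨G ⟨z, hz0⟩, hK₀W ⟨⟨z, hz0⟩, hzr, rfl⟩, hcG ⟨z, hz0⟩ (by simp only; linarith)⟩
  · -- `K` sees `jA(A)` from above
    intro z hz hzA
    obtain ⟨hpW, hcp⟩ := hinv z hz
    obtain ⟨y, hy, hpy⟩ := hΩA _ (hWΩ hpW) hzA
    rw [← hcp, show c (e.symm z) = y.val by rw [hpy]; exact hcG y hy.le]
    exact y.2

end SeamCharts


end Literature.Topology.FourManifolds
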